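import Literature.IUT.LogVolume.ThetaTowerUnramified
import Literature.IUT.LogVolume.Theorem110TowerBridge
import Literature.IUT.LogVolume.Theorem110Data
import HarnessLib

/-!
# [IUTchIV] Thm. 1.10, Step (ii) for the GENUINE theta tower of a point of the `λ`-line — the `K`-level
# different/conductor bound with every ramification hypothesis DISCHARGED

Mochizuki, *Inter-universal Teichmüller theory IV*, RIMS manuscript (Apr. 2020; = PRIMS **57** (2021)),
proof of Thm. 1.10, Step (ii), p. 24: "since the extension `K/F` is tamely ramified at the primes that do
not divide `l`, and we have a natural outer inclusion `Gal(K/F) ↪ GL_2(𝔽_l)`, the inequality `log(𝔡^K) ≤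
log(𝔡^K) + log(𝔣^K) ≤ log(𝔡^F) + log(𝔣^F) + 2·log(l) ≤ log(𝔡^{F_tpd}) + log(𝔣^{F_tpd}) + 2·log(l) + 21`
follows immediately from Proposition 1.3, (i), (ii)" (read directly `F_tpd → K`, cell finding F-Sd1g3-1).

The tree's `Cor22.ndeg_differentDivisor_add_logCondOver_le` (abc-iut-L5-t15, `Theorem110TowerBridge.lean`)
proves the `K`-level bound `log(𝔡^K) + log(𝔣^K) ≤ log(𝔡^{F_tpd}) + log(𝔣^{F_tpd}) + log(2^11·3^3·5^2) +
2·log(l)` for a tower `F_tpd ⊆ F ⊆ K` over a point `P` of the `λ`-line UNDER the ramification/Galois hypotheses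
`hdegF`, `hdegK`, `hKgood`, `hKbad`, `hFgood`, `hFtame` ("the shape abc-iut-S-d1 proves them for the genuine
theta tower"). THIS FILE discharges all six for the GENUINE tower: `F` any theta field of `P`
(`Cor22.IsThetaField`: "`F = F_tpd(√−1, E_{F_tpd}[3·5])`"), `E_F = Cor22.thetaCurve P F` the Legendre curve,
`l ≥ 7` prime, `K ⊇ F` any number field Galois over `F` inside the `l`-division field — presented by an
`F`-embedding `ψ : K → AlgebraicClosure F` with `ker ρ̄_{E_F,l} ≤ Gal(F̄/ψ(K))` (for `K = F(E_F[l])` of [IUTchI]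
Def. 3.1 (c) see the sequel `Theorem110GenuineStepIIDatum.lean`) — from the instance forms of Prop. 1.8 (vi),
(vii) / (D0) in `ThetaTowerRamification.lean`, `ThetaTowerUnramified.lean`:

* `ndeg_differentDivisor_add_logCondOver_thetaTower_le` — **`log(𝔡^K) + log(𝔣^K) ≤ log(𝔡^{F_tpd}) +
  log(𝔣^{F_tpd}) + log(2^11·3^3·5^2) + 2·log(l)`**, hypothesis-free for the genuine tower;
* `proofData_stepii_fields_thetaTower` — the three Step (ii) fields `tpd_le_F`, `F_le`, `K_le` of
  `Thm110Numerics.ProofData` for the genuine tower (with the free `F`-level fields of `Cor22.Matches` set as in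
  `proofData_stepii_fields`);
* `logDiff_thetaTower_le` — **`log(𝔡^K) ≤ log(𝔡^{F_tpd}) + log(𝔣^{F_tpd}) + 2·log(l) + 21`**
  (`log(𝔡^K) = (extend P K).logDiff`), the quantity Steps (iii), (v), (viii) consume
  (`Thm110Numerics.stepii_K_le_tpd_add` for real data).

Classical algebraic number theory about torsion fields of the Legendre curve, kernel-checked by us; TAKES NO
SIDE on [IUTchIII] Cor. 3.12 (not involved).
-/

noncomputable section

open scoped Classical

namespace Literature.IUT.LogVolume

namespace Cor22

open NumberField IsDedekindDomain Literature.NumberTheory.DiophantineGeometry.GenEll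
open Literature.NumberTheory.EllipticCurves Literature.NumberTheory.NumberFields WeierstrassCurve Field

section Helpers

/-- `(l : 𝓞 F) ∉ w` for the place `w` of `F` under a place `u` of `K` of residue characteristic `≠ l`.
[cite: NeukirchANT1999, Ch. I (8.2)] -/
theorem natCast_notMem_finBelow_of_residueChar_ne {F K : Type} [Field F] [NumberField F] [Field K]
    [NumberField K] [Algebra F K] {l : ℕ} (hl : l.Prime) (u : HeightOneSpectrum (𝓞 K))
    (hu : residueChar K u ≠ l) : ((l : ℕ) : 𝓞 F) ∉ (finBelow F K u).asIdeal := by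
  intro h
  rw [natCast_mem_asIdeal_iff_residueChar_eq (finBelow F K u) hl, residueChar_finBelow] at h
  exact hu h

/-- `(30 : 𝓞 F_tpd) ∉ v` for the place `v` of `F_tpd` under a place `w` of `F` of residue characteristic
`∉ {2, 3, 5}`. [cite: NeukirchANT1999, Ch. I (8.2)] -/
theorem thirty_notMem_finBelow_of_residueChar_notMem {P : NFPoint} {F : Type} [Field F] [NumberField F]
    [Algebra P.F F] (w : HeightOneSpectrum (𝓞 F)) (hw : residueChar F w ∉ ({2, 3, 5} : Finset ℕ)) :
    ((30 : ℕ) : 𝓞 P.F) ∉ (finBelow P.F F w).asIdeal := by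
  intro h
  rw [natCast_mem_iff_absNorm_under_dvd P.F (finBelow P.F F w).asIdeal 30] at h
  change residueChar P.F (finBelow P.F F w) ∣ 30 at h
  rw [residueChar_finBelow] at h
  have hp := residueChar_prime F w
  simp only [Finset.mem_insert, Finset.mem_singleton, not_or] at hw
  obtain ⟨h2, h3, h5⟩ := hw
  have h30 : (30 : ℕ) = 2 * 3 * 5 := by norm_num
  rw [h30] at h
  rcases (Nat.Prime.dvd_mul hp).1 h with h23 | h5'
  · rcases (Nat.Prime.dvd_mul hp).1 h23 with h2' | h3'
    · exact h2 ((Nat.prime_dvd_prime_iff_eq hp Nat.prime_two).1 h2')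
    · exact h3 ((Nat.prime_dvd_prime_iff_eq hp Nat.prime_three).1 h3')
  · exact h5 ((Nat.prime_dvd_prime_iff_eq hp (by norm_num)).1 h5')

end Helpers

section Tower

variable {P : NFPoint} {F : Type} [Field F] [NumberField F] [Algebra P.F F]
  {K : Type} [Field K] [NumberField K] [Algebra F K] [Algebra P.F K] [IsScalarTower P.F F K]
  (ψ : K →ₐ[F] AlgebraicClosure F)

/-- **[IUTchIV] Thm. 1.10, Step (ii) for the GENUINE theta tower, hypothesis-free:**
`log(𝔡^K) + log(𝔣^K) ≤ log(𝔡^{F_tpd}) + log(𝔣^{F_tpd}) + log(2^11·3^3·5^2) + 2·log(l)` with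
`log(𝔡^K) = ndeg K (differentDivisor K)`, `log(𝔣^K) = logCondOver P {2,l} K`, `log(𝔡^{F_tpd}) = P.logDiff`,
`log(𝔣^{F_tpd}) = logCondAvoid P {2,l}` — abc-iut-L5-t15's `ndeg_differentDivisor_add_logCondOver_le` with
`hdegF` (`IsThetaField.finrank_dvd`), `hdegK` (`finrank_divisionTower_dvd`), `hKgood`
(`ramificationIdx_divisionTower_eq_one`), `hKbad` (`not_dvd_ramificationIdx_divisionTower`), `hFgood`
(`ramificationIdx_thetaField_eq_one`), `hFtame` (`not_dvd_ramificationIdx_thetaField`) all DISCHARGED.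
[claim: Mochizuki2012, status: disputed] -/
theorem ndeg_differentDivisor_add_logCondOver_thetaTower_le (hU : P.InU) (hF : IsThetaField P F)
    [IsGalois F K] {l : ℕ} (hl : l.Prime) (h7 : 7 ≤ l)
    (hK : letI := thetaCurve_isElliptic hU F
      ((thetaCurve P F).galoisRepTorsion (l : ℤ)).ker ≤ ψ.fieldRange.fixingSubgroup) :
    ndeg K (differentDivisor K) + logCondOver P {2, l} K ≤
      P.logDiff + logCondAvoid P {2, l} + (Real.log (2 ^ 11 * 3 ^ 3 * 5 ^ 2) + 2 * Real.log l) := by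
  haveI := hF.isGalois
  haveI : Fact l.Prime := ⟨hl⟩
  refine ndeg_differentDivisor_add_logCondOver_le P hl h7 F K ?_ (finrank_divisionTower_dvd ψ hU hK)
    ?_ ?_ ?_ ?_
  · have h := hF.finrank_dvd
    norm_num at h ⊢
    exact h
  · intro u hu hgood
    refine ramificationIdx_divisionTower_eq_one ψ hU hF hK u
      (natCast_notMem_finBelow_of_residueChar_ne hl u hu) ?_
    rwa [finBelow_finBelow P.F F K u]
  · intro u hu _
    exact not_dvd_ramificationIdx_divisionTower ψ hU hF hl hK u
      (natCast_notMem_finBelow_of_residueChar_ne hl u hu) (residueChar_prime K u) hu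
  · intro w hw hgood
    exact ramificationIdx_thetaField_eq_one F hU hF w (thirty_notMem_finBelow_of_residueChar_notMem w hw) hgood
  · intro w hw
    simp only [Finset.mem_insert, Finset.mem_singleton, not_or] at hw
    exact not_dvd_ramificationIdx_thetaField F hF w (residueChar_prime F w) hw.1 hw.2.1 hw.2.2

/-- **The three Step (ii) fields of `Thm110Numerics.ProofData` for the genuine tower** (`tpd_le_F`, `F_le`,
`K_le` with the free `F`-level fields of `Cor22.Matches` set to `P.logDiff + log(2^11·3^3·5^2)`,
`logCondAvoid P {2,l}`, and `logDiffK := ndeg K 𝔡^K`, `logCondK := logCondOver P {2,l} K`) —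
abc-iut-L5-t15's `proofData_stepii_fields`, hypotheses discharged. [claim: Mochizuki2012, status: disputed] -/
theorem proofData_stepii_fields_thetaTower (hU : P.InU) (hF : IsThetaField P F) [IsGalois F K] {l : ℕ}
    (hl : l.Prime) (h7 : 7 ≤ l)
    (hK : letI := thetaCurve_isElliptic hU F
      ((thetaCurve P F).galoisRepTorsion (l : ℤ)).ker ≤ ψ.fieldRange.fixingSubgroup) :
    (P.logDiff + logCondAvoid P {2, l} ≤
        (P.logDiff + Real.log (2 ^ 11 * 3 ^ 3 * 5 ^ 2)) + logCondAvoid P {2, l}) ∧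
    ((P.logDiff + Real.log (2 ^ 11 * 3 ^ 3 * 5 ^ 2)) + logCondAvoid P {2, l} ≤
        P.logDiff + logCondAvoid P {2, l} + Real.log (2 ^ 11 * 3 ^ 3 * 5 ^ 2)) ∧
    (ndeg K (differentDivisor K) + logCondOver P {2, l} K ≤
        (P.logDiff + Real.log (2 ^ 11 * 3 ^ 3 * 5 ^ 2)) + logCondAvoid P {2, l} + 2 * Real.log (l : ℕ)) := by
  have h := ndeg_differentDivisor_add_logCondOver_thetaTower_le ψ hU hF hl h7 hK
  have hlog : 0 ≤ Real.log (2 ^ 11 * 3 ^ 3 * 5 ^ 2 : ℝ) := Real.log_nonneg (by norm_num)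
  refine ⟨by linarith, by linarith, by linarith⟩

/-- **`log(𝔡^K) ≤ log(𝔡^{F_tpd}) + log(𝔣^{F_tpd}) + 2·log(l) + 21` for the genuine tower** (Step (ii), third
display, last inequality, p. 24, via `log(𝔣^K) ≥ 0` and (E6) `log(2^11·3^3·5^2) ≤ 21`), `log(𝔡^K)` read as the
normalized log-different `(extend P K).logDiff` of `λ` presented over `K` — the `K`-level different bound of
`Thm110Numerics.stepii_K_le_tpd_add`, UNCONDITIONAL for the genuine tower. [claim: Mochizuki2012, status: disputed] -/
theorem logDiff_thetaTower_le (hU : P.InU) (hF : IsThetaField P F) [IsGalois F K] {l : ℕ} (hl : l.Prime)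
    (h7 : 7 ≤ l)
    (hK : letI := thetaCurve_isElliptic hU F
      ((thetaCurve P F).galoisRepTorsion (l : ℤ)).ker ≤ ψ.fieldRange.fixingSubgroup) :
    (extend P K).logDiff ≤ P.logDiff + logCondAvoid P {2, l} + 2 * Real.log l + 21 := by
  have h := ndeg_differentDivisor_add_logCondOver_thetaTower_le ψ hU hF hl h7 hK
  have hK' : (extend P K).logDiff = ndeg K (differentDivisor K) :=
    logDiff_eq_ndeg_differentDivisor (extend P K)
  have h0 : 0 ≤ logCondOver P {2, l} K := logCondOver_nonneg P {2, l} K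
  have h21 := log_two_pow_eleven_mul_le
  rw [hK']
  linarith

end Tower

end Cor22

end Literature.IUT.LogVolume

end
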